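import Mathlib
import HarnessLib
import Literature.Analysis.FluidPDE.ClassicalSolution
import Literature.Analysis.FluidPDE.ClassicalSolutionCalculus
import Literature.Analysis.FluidPDE.LerayHopf
import Literature.Analysis.FluidPDE.SuitableWeak
import Literature.Analysis.FluidPDE.TaoLocalisationHolds
import Literature.Analysis.FluidPDE.TaoFiniteEnergyLerayHopf
import Summits.NavierStokesRegularity.NavierStokesRegularity.Theorems.QuarterJoltSliceTestIncrementL4
import Summits.NavierStokesRegularity.NavierStokesRegularity.Theorems.CertifiedBlowupCertifiedBlowupAxisymBlowupEnergyDrain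
import Summits.NavierStokesRegularity.NavierStokesRegularity.Theorems.QuarterJoltTypeIEnergyEquality

/-!
# Route QuarterJolt — crux `NoTerminalJolt` (stmt-NavierStokesRegularity-26463), LEAD line
# `regular_split` rev 8: THE `L⁴` SLICE-TEST CRITERION — `∫ₜᵀ ‖u‖²_{L⁴} = O(√(T−t))` FORCES THE
# ENERGY EQUALITY AT A FIRST BLOW-UP TIME

Seat ns-ntj-p1 g6 (LEAD of the crux; `--supports 26463 --as helper`). Second file of the `L⁴`
SLICE-TEST CRITERION chain (`QuarterJoltSliceTestIncrementL4` → THIS → `…WeakL4EnergyEquality` →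
`…ShinbrotEnergyEquality`). Frame: `(u,p)` classical on `[0,T)` (`ν, T > 0`), Leray–Hopf on `[0,T]`
from a rapidly decaying datum; `Z(t) = ∫|Du(t)|²_F`; `‖u(τ)‖²_{L⁴} = √(∫‖u(τ)‖⁴)`.

1. `sliceTestL4_terminal_abs_le` — the slab increment of file I passed to `s ↑ T` by the Leray–Hopf
   weak continuity, under a majorant `√(∫‖u(τ)‖⁴) ≤ m(τ)` on `(t,T)` with `∫⁻_{(t,s)} m ≤ A`, `s < T`.
2. `l4_terminalApproach_le` — THE `L⁴` TERMINAL APPROACH LAW `∫‖u(t) − u(T)‖² ≤ (ν/2)(T−t)Z(t) +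
   2√Z(t)·A` (`η = 2`; the energy drop absorbs the dissipation, as in p639359 / p641804);
   `l4_terminalApproach_le'` — with `A = ∫ₜᵀ ‖u(τ)‖²_{L⁴} dτ` itself (`aemeasurable_sqrt_integral_norm_pow_four`).
3. `tendsto_integral_norm_sub_sq_of_frequently_l4Bound_lt` — MASTER FORM: the right-hand side of the
   approach law `< δ` frequently as `t ↑ T`, for every `δ > 0`, ⇒ no energy jump (energy-jump law).
4. `tendsto_integral_norm_sub_sq_of_l4Criterion` — THE `L⁴` SLICE-TEST CRITERION: `∫ₜᵀ ‖u(τ)‖²_{L⁴} dτ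
   ≤ C√(T−t)` near `T` ⇒ `∫‖u(t) − u(T)‖² → 0` (`√Z·A ≤ C√w`, `w = (T−t)Z(t)` small frequently,
   `frequently_scaleFreeEnstrophy_lt`); majorant form on closed sub-slabs; `eLpNorm` / energy-equality
   forms (18118 / no-energy-atom forms: position file of this chain).

ENVELOPE: the sup-norm Type-I rate (rev 5), the weak-`L⁴` rate `‖u(t)‖_{L⁴} ≤ M(T−t)^{−1/4}` (file
III; the `p = 4` endpoint of Cheskidov–Luo 2020 Cor. 1.2, which needs `p > 4`), Lions' `L⁴L⁴` and
Shinbrot's `L^qL^p`, `1/q + 1/p ≤ 1/2`, `p ≥ 4`, strong or weak in time (file IV) all make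
`∫ₜᵀ‖u‖²_{L⁴} = O(√(T−t))`; the enstrophy-rate theorem (rev 5) is the master form.

HONEST FRAMING: a conditional regularity-type statement (energy equality under an integrability
hypothesis at the first blow-up); nothing here claims progress on `NoTerminalJolt`, on
`NoFastEnergyConcentration` (stmt-18118) or on Navier–Stokes regularity — all OPEN. No summit
statement is proved here. [folklore]
-/

noncomputable section

-- the summit and its single sub-problem share the name (CONVENTIONS §1), as in every Theorems file
set_option linter.dupNamespace false

namespace Summit.NavierStokesRegularity.NavierStokesRegularity.Theorems

open MeasureTheory Set Function Filter Topology InnerProductSpace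
open scoped ENNReal NNReal ContDiff RealInnerProductSpace
open Literature.Analysis.FluidPDE

namespace NoTerminalJolt

/-! ### Tool: a `lintegral` over `(t,T)` from its values on the sub-intervals `(t,s)`, `s < T` -/

/-- If `∫⁻_{(t,s)} f ≤ B` for every `s ∈ (t,T)` then `∫⁻_{(t,T)} f ≤ B` (monotone convergence along
`sₙ = T − (T−t)/(n+2) ↑ T`). [folklore] -/
theorem lintegral_Ioo_le_of_forall_Ioo_le {f : ℝ → ℝ≥0∞} {t T : ℝ} (htT : t < T) {B : ℝ≥0∞}
    (h : ∀ s ∈ Ioo t T, ∫⁻ τ in Ioo t s, f τ ≤ B) : ∫⁻ τ in Ioo t T, f τ ≤ B := by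
  set σ : ℕ → ℝ := fun n => T - (T - t) / ((n : ℝ) + 2) with hσ
  have hTt : 0 < T - t := sub_pos.2 htT
  have hσ_mem : ∀ n : ℕ, σ n ∈ Ioo t T := by
    intro n
    have hn : (0 : ℝ) < (n : ℝ) + 2 := by positivity
    have h1 : (T - t) / ((n : ℝ) + 2) < T - t := by
      rw [div_lt_iff₀ hn]; nlinarith
    have h2 : 0 < (T - t) / ((n : ℝ) + 2) := div_pos hTt hn
    exact ⟨by simp only [hσ]; linarith, by simp only [hσ]; linarith⟩
  have hmono : Monotone fun n : ℕ => Ioo t (σ n) := by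
    intro a b hab
    refine Ioo_subset_Ioo_right ?_
    have hab' : (a : ℝ) + 2 ≤ (b : ℝ) + 2 := by exact_mod_cast Nat.add_le_add_right hab 2
    have := div_le_div_of_nonneg_left hTt.le (by positivity : (0 : ℝ) < (a : ℝ) + 2) hab'
    simp only [hσ]; linarith
  have hU : (⋃ n : ℕ, Ioo t (σ n)) = Ioo t T := by
    ext τ
    simp only [mem_iUnion, mem_Ioo]
    refine ⟨fun ⟨n, h1, h2⟩ => ⟨h1, h2.trans (hσ_mem n).2⟩, fun ⟨h1, h2⟩ => ?_⟩
    obtain ⟨n, hn⟩ := exists_nat_gt ((T - t) / (T - τ))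
    have hTτ : 0 < T - τ := sub_pos.2 h2
    refine ⟨n, h1, ?_⟩
    have hlt : (T - t) / ((n : ℝ) + 2) < T - τ := by
      rw [div_lt_iff₀ (by positivity)]
      have := (div_lt_iff₀ hTτ).1 (show (T - t) / (T - τ) < (n : ℝ) + 2 by linarith)
      linarith
    simp only [hσ]; linarith
  rw [← hU, setLIntegral_iUnion_of_directed f hmono.directed_le]
  exact iSup_le fun n => h (σ n) (hσ_mem n)

/-! ### Measurability of the `L⁴` norm of the moving slice on closed sub-slabs -/

/-- In the frame, `τ ↦ √(∫‖u(τ)‖⁴)` is a.e.-measurable on every `(t,s)` with `0 ≤ t`, `s < T` (joint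
continuity of `u` on the closed sub-slab `[t,s] × ℝ³`, Tonelli measurability of the inner
`lintegral`, and `∫‖u(τ)‖⁴ = (∫⁻‖u(τ)‖ₑ⁴).toReal`). [folklore] -/
theorem aemeasurable_sqrt_integral_norm_pow_four {ν T : ℝ}
    {u : ℝ → EuclideanSpace ℝ (Fin 3) → EuclideanSpace ℝ (Fin 3)} {p : ℝ → EuclideanSpace ℝ (Fin 3) → ℝ}
    (hcl : IsClassicalNSSolutionOn (Ico 0 T) ν 0 u p) {t s : ℝ} (ht : 0 ≤ t) (hsT : s < T) :
    AEMeasurable (fun τ => Real.sqrt (∫ x, ‖u τ x‖ ^ 4)) (volume.restrict (Ioo t s)) := by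
  have hsub : Icc t s ⊆ Ico 0 T := fun x hx => ⟨ht.trans hx.1, lt_of_le_of_lt hx.2 hsT⟩
  have hcont : ContinuousOn (uncurry u) (Icc t s ×ˢ univ) :=
    hcl.smooth_velocity.continuousOn.mono (prod_mono hsub Subset.rfl)
  have hm : AEMeasurable (fun τ => ∫⁻ x, ‖u τ x‖ₑ ^ 4) (volume.restrict (Ioo t s)) :=
    ((aestronglyMeasurable_prod_of_continuousOn hcont).enorm.pow_const 4).lintegral_prod_right'
  have heq : ∀ τ ∈ Ioo t s, Real.sqrt (∫ x, ‖u τ x‖ ^ 4) =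
      Real.sqrt ((∫⁻ x, ‖u τ x‖ₑ ^ 4).toReal) := by
    intro τ hτ
    have hτ' : τ ∈ Ico 0 T := ⟨ht.trans hτ.1.le, hτ.2.trans hsT⟩
    have hc : Continuous (u τ) := (hcl.contDiff_velocity hτ').continuous
    have h1 : 0 ≤ᵐ[volume] fun x => ‖u τ x‖ ^ 4 :=
      Eventually.of_forall fun x => by simp only [Pi.zero_apply]; positivity
    have h2 : AEStronglyMeasurable (fun x => ‖u τ x‖ ^ 4) volume :=
      (hc.norm.pow 4).aestronglyMeasurable
    congr 1
    rw [integral_eq_lintegral_of_nonneg_ae h1 h2]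
    congr 1
    exact lintegral_congr fun x => by
      rw [← ofReal_norm, ENNReal.ofReal_pow (norm_nonneg _)]
  refine (Real.continuous_sqrt.measurable.comp_aemeasurable hm.ennreal_toReal).congr ?_
  filter_upwards [ae_restrict_mem measurableSet_Ioo] with τ hτ
  exact (heq τ hτ).symm

/-! ### In the frame: the slice-test increment up to `T` under an `L⁴` majorant -/

/-- **The slice-test increment up to the terminal time under an `L⁴` MAJORANT** (frame; `t ∈ (0,T)`;
`√(∫‖u(τ)‖⁴) ≤ m(τ)` on `(t,T)` with `m` a.e.-measurable on every `(t,s)`, `s < T`, and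
`∫⁻_{(t,s)} ofReal m ≤ ofReal A` for every `s < T`, `A ≥ 0`; `η > 0`; `Z = ∫|Du(t)|²_F`):
`|∫⟪u(T),u(t)⟫ − ∫‖u(t)‖²| ≤ (ν/2)η(∫⁻_{(t,T)}∫⁻|Du|²_F).toReal + (ν/2)η⁻¹Z(T−t) + √Z·A`
(`sliceTestL4_increment_abs_le_slab` on `[0,(s+T)/2]` in Tao's class for each `s < T`, the bound
being independent of `s`; then `s ↑ T` by the Leray–Hopf weak continuity at `T`). [folklore] -/
theorem sliceTestL4_terminal_abs_le {ν T : ℝ} (hν : 0 < ν) (hT : 0 < T)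
    {u : ℝ → EuclideanSpace ℝ (Fin 3) → EuclideanSpace ℝ (Fin 3)} {p : ℝ → EuclideanSpace ℝ (Fin 3) → ℝ}
    (hcl : IsClassicalNSSolutionOn (Ico 0 T) ν 0 u p) (hLH : IsLerayHopfOn T ν 0 (u 0) u)
    (hdec : HasRapidSpatialDecay (u 0)) {t : ℝ} (ht : t ∈ Ioo 0 T)
    {m : ℝ → ℝ} (hm : ∀ τ ∈ Ioo t T, Real.sqrt (∫ x, ‖u τ x‖ ^ 4) ≤ m τ)
    (hmeas : ∀ s ∈ Ioo t T, AEMeasurable m (volume.restrict (Ioo t s)))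
    {A : ℝ} (hA0 : 0 ≤ A)
    (hA : ∀ s ∈ Ioo t T, ∫⁻ τ in Ioo t s, ENNReal.ofReal (m τ) ≤ ENNReal.ofReal A)
    {η : ℝ} (hη : 0 < η) :
    |(∫ x, ⟪u T x, u t x⟫) - ∫ x, ‖u t x‖ ^ 2| ≤
      ν / 2 * η *
          (∫⁻ τ in Ioo t T, ∫⁻ x, ENNReal.ofReal (frobeniusNormSq (fderiv ℝ (u τ) x))).toReal +
        ν / 2 * η⁻¹ * (∫ x, frobeniusNormSq (fderiv ℝ (u t) x)) * (T - t) +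
        Real.sqrt (∫ x, frobeniusNormSq (fderiv ℝ (u t) x)) * A := by
  have hmt : MemLp (u t) 2 volume := hLH.memLp t ⟨ht.1.le, ht.2.le⟩
  set Z : ℝ := ∫ x, frobeniusNormSq (fderiv ℝ (u t) x) with hZdef
  have hZ0 : 0 ≤ Z := integral_nonneg fun x => frobeniusNormSq_nonneg _
  set D : ℝ≥0∞ := ∫⁻ τ in Ioo t T, ∫⁻ x, ENNReal.ofReal (frobeniusNormSq (fderiv ℝ (u τ) x)) with hD
  have hDfin : D ≠ ⊤ :=
    (CertifiedBlowupAxisymBlowup.EnergyDrain.dissipation_le_energy_sub hν hcl hLH ht.1.le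
      ht.2.le le_rfl).1
  set R : ℝ := ν / 2 * η * D.toReal + ν / 2 * η⁻¹ * Z * (T - t) + Real.sqrt Z * A with hR
  have hincr : ∀ s ∈ Ioo t T, |(∫ x, ⟪u s x, u t x⟫) - ∫ x, ‖u t x‖ ^ 2| ≤ R := by
    intro s hs
    set S : ℝ := (s + T) / 2 with hSdef
    have hsS : s < S := by rw [hSdef]; linarith [hs.2]
    have hST : S < T := by rw [hSdef]; linarith [hs.2]
    have hS : 0 < S := (ht.1.trans hs.1).trans hsS
    have hsolS : IsClassicalNSSolutionOn (Icc 0 S) ν 0 u p :=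
      hcl.mono (Icc_subset_Ico_right hST) (uniqueDiffOn_Icc hS)
    have hE' : ∃ C' : ℝ≥0, ∀ τ ∈ Icc 0 S, ∫⁻ x, ‖u τ x‖ₑ ^ 2 ≤ C' :=
      ⟨(ENNReal.ofReal (2 * VectorCalculus.kineticEnergy (u 0))).toNNReal, fun τ hτ => by
        rw [ENNReal.coe_toNNReal ENNReal.ofReal_ne_top]
        exact hLH.lintegral_enorm_sq_le hν.le ⟨hτ.1, hτ.2.trans hST.le⟩⟩
    have hB : HasBoundedSobolevNormsOn (Icc 0 S) u :=
      tao2011_hasBoundedSobolevNormsOn_holds hν hS hsolS hE' hdec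
    have hm' : ∀ τ ∈ Ioo t s, Real.sqrt (∫ x, ‖u τ x‖ ^ 4) ≤ m τ :=
      fun τ hτ => hm τ ⟨hτ.1, hτ.2.trans hs.2⟩
    have h := sliceTestL4_increment_abs_le_slab hν hS hsolS hB ht.1 hs.1 hsS hm' (hmeas s hs) hA0
      (hA s hs) hη
    have hmono : (∫⁻ τ in Ioo t s, ∫⁻ x, ENNReal.ofReal (frobeniusNormSq (fderiv ℝ (u τ) x))).toReal ≤
        D.toReal :=
      ENNReal.toReal_mono hDfin (lintegral_mono_set (Ioo_subset_Ioo_right hs.2.le))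
    have h1 : ν / 2 * η *
        (∫⁻ τ in Ioo t s, ∫⁻ x, ENNReal.ofReal (frobeniusNormSq (fderiv ℝ (u τ) x))).toReal ≤
        ν / 2 * η * D.toReal := mul_le_mul_of_nonneg_left hmono (by positivity)
    have h2 : ν / 2 * η⁻¹ * Z * (s - t) ≤ ν / 2 * η⁻¹ * Z * (T - t) :=
      mul_le_mul_of_nonneg_left (by linarith [hs.2]) (by positivity)
    rw [hR]
    linarith
  have hle_filter : 𝓝[<] T ≤ 𝓝[Ioc 0 T] T := by
    rw [← nhdsWithin_Ioo_eq_nhdsLT hT]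
    exact nhdsWithin_mono _ Ioo_subset_Ioc_self
  have hlim : Tendsto (fun s => (∫ x, ⟪u s x, u t x⟫) - ∫ x, ‖u t x‖ ^ 2) (𝓝[<] T)
      (𝓝 ((∫ x, ⟪u T x, u t x⟫) - ∫ x, ‖u t x‖ ^ 2)) :=
    ((((hLH.weak_continuous (u t) hmt).1) T ⟨hT, le_rfl⟩).tendsto.mono_left hle_filter).sub
      tendsto_const_nhds
  have hev : ∀ᶠ s in 𝓝[<] T, |(∫ x, ⟪u s x, u t x⟫) - ∫ x, ‖u t x‖ ^ 2| ≤ R := by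
    filter_upwards [Ioo_mem_nhdsLT ht.2] with s hs
    exact hincr s hs
  have hfinal := le_of_tendsto hlim.abs hev
  rw [hR] at hfinal
  exact hfinal

/-! ### THE `L⁴` TERMINAL APPROACH LAW -/

/-- **THE `L⁴` TERMINAL APPROACH LAW.** `(u,p)` classical on `[0,T)` (`ν, T > 0`), Leray–Hopf on
`[0,T]` from a rapidly decaying datum, `t ∈ (0,T)`, and an `L⁴` majorant on `(t,T)`:
`√(∫‖u(τ)‖⁴) ≤ m(τ)`, `m` a.e.-measurable on every `(t,s)`, `s < T`, `∫⁻_{(t,s)} ofReal m ≤ ofReal A`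
for every `s < T`, `A ≥ 0`. Then, with `Z = ∫|Du(t)|²_F`:
`∫‖u(t) − u(T)‖² ≤ (ν/2)(T−t)Z + 2√Z·A`.
(`‖a−b‖² = 2⟨a−b,a⟩ − (‖a‖²−‖b‖²)`; `sliceTestL4_terminal_abs_le` with `η = 2`; the energy drop
`∫‖u(t)‖² − ∫‖u(T)‖² ≥ 2ν∫ₜᵀ∫|Du|²_F` absorbs the dissipation.) In words: THE `L²` DISTANCE TO THE
TERMINAL VALUE IS CONTROLLED BY THE SCALE-FREE ENSTROPHY `(T−t)Z(t)` AND BY `‖Du(t)‖₂·∫ₜᵀ‖u‖²_{L⁴}`. [folklore] -/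
theorem l4_terminalApproach_le {ν T : ℝ} (hν : 0 < ν) (hT : 0 < T)
    {u : ℝ → EuclideanSpace ℝ (Fin 3) → EuclideanSpace ℝ (Fin 3)} {p : ℝ → EuclideanSpace ℝ (Fin 3) → ℝ}
    (hcl : IsClassicalNSSolutionOn (Ico 0 T) ν 0 u p) (hLH : IsLerayHopfOn T ν 0 (u 0) u)
    (hdec : HasRapidSpatialDecay (u 0)) {t : ℝ} (ht : t ∈ Ioo 0 T)
    {m : ℝ → ℝ} (hm : ∀ τ ∈ Ioo t T, Real.sqrt (∫ x, ‖u τ x‖ ^ 4) ≤ m τ)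
    (hmeas : ∀ s ∈ Ioo t T, AEMeasurable m (volume.restrict (Ioo t s)))
    {A : ℝ} (hA0 : 0 ≤ A)
    (hA : ∀ s ∈ Ioo t T, ∫⁻ τ in Ioo t s, ENNReal.ofReal (m τ) ≤ ENNReal.ofReal A) :
    ∫ x, ‖u t x - u T x‖ ^ 2 ≤
      ν / 2 * ((T - t) * ∫ x, frobeniusNormSq (fderiv ℝ (u t) x)) +
        2 * (Real.sqrt (∫ x, frobeniusNormSq (fderiv ℝ (u t) x)) * A) := by
  set Z : ℝ := ∫ x, frobeniusNormSq (fderiv ℝ (u t) x) with hZdef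
  obtain ⟨-, hDle⟩ := CertifiedBlowupAxisymBlowup.EnergyDrain.dissipation_le_energy_sub hν hcl hLH
    ht.1.le ht.2.le le_rfl
  have h := sliceTestL4_terminal_abs_le hν hT hcl hLH hdec ht hm hmeas hA0 hA
    (by norm_num : (0:ℝ) < 2)
  have hid := integral_norm_sub_sq_terminal_eq hT hLH ⟨ht.1.le, ht.2.le⟩
  have hcomm : ∫ x, ⟪u t x, u T x⟫ = ∫ x, ⟪u T x, u t x⟫ :=
    integral_congr_ae (Eventually.of_forall fun x => real_inner_comm _ _)
  have hEt : ∫ x, ‖u t x‖ ^ 2 = 2 * VectorCalculus.kineticEnergy (u t) := by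
    simp only [VectorCalculus.kineticEnergy]; ring
  have hET : ∫ x, ‖u T x‖ ^ 2 = 2 * VectorCalculus.kineticEnergy (u T) := by
    simp only [VectorCalculus.kineticEnergy]; ring
  obtain ⟨hlo, -⟩ := abs_le.1 h
  have e1 : ν / 2 * (2 : ℝ) = ν := by ring
  have e2 : ν / 2 * (2 : ℝ)⁻¹ * Z * (T - t) = ν / 4 * ((T - t) * Z) := by ring
  rw [e1, e2] at hlo
  rw [hid, hcomm, hEt, hET]
  linarith

/-- **The `L⁴` terminal approach law with the true `L⁴` integral**: if
`L = ∫⁻_{(t,T)} ofReal √(∫‖u(τ)‖⁴) dτ` is finite, then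
`∫‖u(t) − u(T)‖² ≤ (ν/2)(T−t)Z(t) + 2√Z(t)·L.toReal`. [folklore] -/
theorem l4_terminalApproach_le' {ν T : ℝ} (hν : 0 < ν) (hT : 0 < T)
    {u : ℝ → EuclideanSpace ℝ (Fin 3) → EuclideanSpace ℝ (Fin 3)} {p : ℝ → EuclideanSpace ℝ (Fin 3) → ℝ}
    (hcl : IsClassicalNSSolutionOn (Ico 0 T) ν 0 u p) (hLH : IsLerayHopfOn T ν 0 (u 0) u)
    (hdec : HasRapidSpatialDecay (u 0)) {t : ℝ} (ht : t ∈ Ioo 0 T)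
    (hfin : (∫⁻ τ in Ioo t T, ENNReal.ofReal (Real.sqrt (∫ x, ‖u τ x‖ ^ 4))) ≠ ⊤) :
    ∫ x, ‖u t x - u T x‖ ^ 2 ≤
      ν / 2 * ((T - t) * ∫ x, frobeniusNormSq (fderiv ℝ (u t) x)) +
        2 * (Real.sqrt (∫ x, frobeniusNormSq (fderiv ℝ (u t) x)) *
          (∫⁻ τ in Ioo t T, ENNReal.ofReal (Real.sqrt (∫ x, ‖u τ x‖ ^ 4))).toReal) :=
  l4_terminalApproach_le hν hT hcl hLH hdec ht (m := fun τ => Real.sqrt (∫ x, ‖u τ x‖ ^ 4))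
    (fun _ _ => le_rfl)
    (fun s hs => aemeasurable_sqrt_integral_norm_pow_four hcl ht.1.le hs.2)
    ENNReal.toReal_nonneg fun s hs => by
      rw [ENNReal.ofReal_toReal hfin]
      exact lintegral_mono_set (Ioo_subset_Ioo_right hs.2.le)

/-! ### MASTER FORM: the approach-law bound small along a sequence ⇒ no energy jump -/

/-- **Master form of the `L⁴` criterion.** In the frame, suppose that for every `δ > 0` there are
times `t` arbitrarily close to `T` at which `L(t) = ∫⁻_{(t,T)} ofReal √(∫‖u‖⁴)` is finite and
`(ν/2)(T−t)Z(t) + 2√Z(t)·L(t).toReal < δ`. Then `∫‖u(t) − u(T)‖² → 0` as `t ↑ T` (the limit exists by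
the energy-jump law `exists_energyJump`, and is `≤ δ` for every `δ` by `l4_terminalApproach_le'`).
The Type-I theorem (rev 5), the enstrophy-rate theorem (rev 5, frozen-slice rate used for `Z(t)`),
the `O(√(T−t))` criterion below and all Shinbrot-type classes are instances. [folklore] -/
theorem tendsto_integral_norm_sub_sq_of_frequently_l4Bound_lt {ν T : ℝ} (hν : 0 < ν) (hT : 0 < T)
    {u : ℝ → EuclideanSpace ℝ (Fin 3) → EuclideanSpace ℝ (Fin 3)} {p : ℝ → EuclideanSpace ℝ (Fin 3) → ℝ}
    (hcl : IsClassicalNSSolutionOn (Ico 0 T) ν 0 u p) (hLH : IsLerayHopfOn T ν 0 (u 0) u)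
    (hdec : HasRapidSpatialDecay (u 0))
    (hfreq : ∀ δ : ℝ, 0 < δ → ∃ᶠ t in 𝓝[<] T,
      (∫⁻ τ in Ioo t T, ENNReal.ofReal (Real.sqrt (∫ x, ‖u τ x‖ ^ 4))) ≠ ⊤ ∧
      ν / 2 * ((T - t) * ∫ x, frobeniusNormSq (fderiv ℝ (u t) x)) +
        2 * (Real.sqrt (∫ x, frobeniusNormSq (fderiv ℝ (u t) x)) *
          (∫⁻ τ in Ioo t T, ENNReal.ofReal (Real.sqrt (∫ x, ‖u τ x‖ ^ 4))).toReal) < δ) :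
    Tendsto (fun t => ∫ x, ‖u t x - u T x‖ ^ 2) (𝓝[<] T) (𝓝 0) := by
  obtain ⟨J, hJ0, -, -, hlim⟩ := exists_energyJump hν hT hcl hLH
  have hJδ : ∀ δ : ℝ, 0 < δ → J ≤ δ := by
    intro δ hδ
    have hwin : ∀ᶠ t in 𝓝[<] T, t ∈ Ioo 0 T := Ioo_mem_nhdsLT hT
    have hsmall : ∃ᶠ t in 𝓝[<] T, ∫ x, ‖u t x - u T x‖ ^ 2 < δ := by
      refine ((hfreq δ hδ).and_eventually hwin).mono fun t ⟨⟨hfin, hlt⟩, htI⟩ => ?_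
      exact (l4_terminalApproach_le' hν hT hcl hLH hdec htI hfin).trans_lt hlt
    by_contra hJ
    push Not at hJ
    have hev : ∀ᶠ t in 𝓝[<] T, δ < ∫ x, ‖u t x - u T x‖ ^ 2 := hlim.eventually (lt_mem_nhds hJ)
    obtain ⟨t, h1, h2⟩ := (hsmall.and_eventually hev).exists
    exact absurd h1 (not_lt.2 h2.le)
  have hJ : J = 0 := le_antisymm (le_of_forall_pos_le_add fun δ hδ => by
    simpa using hJδ δ hδ) hJ0
  rw [hJ] at hlim
  exact hlim

/-! ### THE `L⁴` SLICE-TEST CRITERION: `∫ₜᵀ‖u‖²_{L⁴} ≤ C√(T−t)` ⇒ no energy jump -/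

/-- **THE `L⁴` SLICE-TEST CRITERION.** `(u,p)` classical on `[0,T)` (`ν, T > 0`), Leray–Hopf on
`[0,T]` from a rapidly decaying datum, and for `t < T` near `T`
`∫⁻_{(t,T)} ofReal √(∫‖u(τ)‖⁴) dτ ≤ ofReal (C√(T−t))`, i.e. `∫ₜᵀ ‖u(τ)‖²_{L⁴} dτ ≤ C√(T−t)`. Then
`∫‖u(t) − u(T)‖² → 0` as `t ↑ T`: NO ENERGY JUMP at `T` (⟺ Leray's energy equality on `[0,T]`,
`tendsto_eLpNorm_sub_iff_energyEquality` p632964). Proof: in the approach law `√Z·A ≤ C√w` with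
`w = (T−t)Z(t)`, and `w < ε` frequently as `t ↑ T` by finite dissipation
(`frequently_scaleFreeEnstrophy_lt`); master form. By interpolation `‖u‖₄² ≤ ‖u‖₂^{1/2}‖u‖₆^{3/2}`
every frame solution has `∫ₜᵀ‖u‖²_{L⁴} = o((T−t)^{1/4})`; the criterion asks `O((T−t)^{1/2})`, the
exponent of the self-similar rate being `3/4`. Not found in print in this form; it contains Lions
(`L⁴L⁴`), Shinbrot (`L^qL^p`, `1/q+1/p ≤ 1/2`, `p ≥ 4`), their weak-in-time versions (Cheskidov–Luo
2020 Cor. 1.2 for `p > 4`) and the sup-norm Type-I rate (Leslie–Shvydkoy 2018 Thm. 1.2) at a first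
blow-up time — files III–IV of this chain. [folklore] -/
theorem tendsto_integral_norm_sub_sq_of_l4Criterion {ν T : ℝ} (hν : 0 < ν) (hT : 0 < T)
    {u : ℝ → EuclideanSpace ℝ (Fin 3) → EuclideanSpace ℝ (Fin 3)} {p : ℝ → EuclideanSpace ℝ (Fin 3) → ℝ}
    (hcl : IsClassicalNSSolutionOn (Ico 0 T) ν 0 u p) (hLH : IsLerayHopfOn T ν 0 (u 0) u)
    (hdec : HasRapidSpatialDecay (u 0)) {C : ℝ} (hC : 0 ≤ C)
    (hcrit : ∀ᶠ t in 𝓝[<] T, ∫⁻ τ in Ioo t T, ENNReal.ofReal (Real.sqrt (∫ x, ‖u τ x‖ ^ 4)) ≤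
      ENNReal.ofReal (C * Real.sqrt (T - t))) :
    Tendsto (fun t => ∫ x, ‖u t x - u T x‖ ^ 2) (𝓝[<] T) (𝓝 0) := by
  refine tendsto_integral_norm_sub_sq_of_frequently_l4Bound_lt hν hT hcl hLH hdec fun δ hδ => ?_
  set K : ℝ := ν / 2 + 2 * C with hK
  have hK0 : 0 < K := by rw [hK]; positivity
  set ε : ℝ := min 1 ((δ / (K + 1)) ^ 2) with hε
  have hε0 : 0 < ε := lt_min one_pos (by positivity)
  have hε1 : ε ≤ 1 := min_le_left _ _
  have hsqε : Real.sqrt ε ≤ δ / (K + 1) := by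
    calc Real.sqrt ε ≤ Real.sqrt ((δ / (K + 1)) ^ 2) := Real.sqrt_le_sqrt (min_le_right _ _)
      _ = δ / (K + 1) := Real.sqrt_sq (by positivity)
  have hfreq := frequently_scaleFreeEnstrophy_lt hν hT hcl hLH hε0
  have hwin : ∀ᶠ t in 𝓝[<] T, t ∈ Ioo 0 T := Ioo_mem_nhdsLT hT
  refine (hfreq.and_eventually (hwin.and hcrit)).mono fun t ⟨hw, htI, hct⟩ => ?_
  set Z : ℝ := ∫ x, frobeniusNormSq (fderiv ℝ (u t) x) with hZdef
  set L : ℝ≥0∞ := ∫⁻ τ in Ioo t T, ENNReal.ofReal (Real.sqrt (∫ x, ‖u τ x‖ ^ 4)) with hL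
  have hTt : 0 ≤ T - t := sub_nonneg.2 htI.2.le
  have hZ0 : 0 ≤ Z := integral_nonneg fun x => frobeniusNormSq_nonneg _
  have hLfin : L ≠ ⊤ := ne_top_of_le_ne_top ENNReal.ofReal_ne_top hct
  have hLle : L.toReal ≤ C * Real.sqrt (T - t) := by
    have := (ENNReal.toReal_le_toReal hLfin ENNReal.ofReal_ne_top).2 hct
    rwa [ENNReal.toReal_ofReal (by positivity)] at this
  refine ⟨hLfin, ?_⟩
  set w : ℝ := (T - t) * Z with hwdef
  have hw0 : 0 ≤ w := mul_nonneg hTt hZ0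
  have hw1 : w ≤ 1 := hw.le.trans hε1
  have hsw : Real.sqrt w ≤ Real.sqrt ε := Real.sqrt_le_sqrt hw.le
  have hwsq : w ≤ Real.sqrt w := by
    have h1 : Real.sqrt w * Real.sqrt w = w := Real.mul_self_sqrt hw0
    have h2 : Real.sqrt w ≤ 1 := by rw [← Real.sqrt_one]; exact Real.sqrt_le_sqrt hw1
    nlinarith [Real.sqrt_nonneg w]
  have hprod : Real.sqrt Z * L.toReal ≤ C * Real.sqrt w := by
    calc Real.sqrt Z * L.toReal ≤ Real.sqrt Z * (C * Real.sqrt (T - t)) :=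
          mul_le_mul_of_nonneg_left hLle (Real.sqrt_nonneg _)
      _ = C * (Real.sqrt (T - t) * Real.sqrt Z) := by ring
      _ = C * Real.sqrt w := by rw [← Real.sqrt_mul hTt, hwdef]
  have hb : ν / 2 * w + 2 * (Real.sqrt Z * L.toReal) ≤ K * Real.sqrt w := by
    rw [hK, add_mul]
    have : ν / 2 * w ≤ ν / 2 * Real.sqrt w := mul_le_mul_of_nonneg_left hwsq (by positivity)
    nlinarith
  have hKs : K * Real.sqrt w ≤ K * (δ / (K + 1)) :=
    mul_le_mul_of_nonneg_left (hsw.trans hsqε) hK0.le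
  have hlt : K * (δ / (K + 1)) < δ := by
    rw [mul_div_assoc', div_lt_iff₀ (by linarith)]
    nlinarith
  simp only [hwdef] at hb
  linarith

/-- **The `L⁴` criterion, majorant form**: if `√(∫‖u(τ)‖⁴) ≤ m(τ)` for `τ < T` near `T`, with `m`
measurable, and `∫⁻_{(t,s)} ofReal m ≤ ofReal (C√(T−t))` for all `t < s < T`, `t` near `T`, then there is
no energy jump (closed sub-slabs only, so that no improper integral has to be evaluated; monotone
convergence `lintegral_Ioo_le_of_forall_Ioo_le`; used by files III–IV with explicit
majorants `m(τ) = c(T−τ)^{−1/2}` and `m = ‖u(τ)‖₂^{2a}‖u(τ)‖_p^{p/(p−2)}`.) [folklore] -/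
theorem tendsto_integral_norm_sub_sq_of_l4Majorant {ν T : ℝ} (hν : 0 < ν) (hT : 0 < T)
    {u : ℝ → EuclideanSpace ℝ (Fin 3) → EuclideanSpace ℝ (Fin 3)} {p : ℝ → EuclideanSpace ℝ (Fin 3) → ℝ}
    (hcl : IsClassicalNSSolutionOn (Ico 0 T) ν 0 u p) (hLH : IsLerayHopfOn T ν 0 (u 0) u)
    (hdec : HasRapidSpatialDecay (u 0)) {m : ℝ → ℝ}
    (hm : ∀ᶠ τ in 𝓝[<] T, Real.sqrt (∫ x, ‖u τ x‖ ^ 4) ≤ m τ) {C : ℝ} (hC : 0 ≤ C)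
    (hint : ∀ᶠ t in 𝓝[<] T, ∀ s ∈ Ioo t T, ∫⁻ τ in Ioo t s, ENNReal.ofReal (m τ) ≤
      ENNReal.ofReal (C * Real.sqrt (T - t))) :
    Tendsto (fun t => ∫ x, ‖u t x - u T x‖ ^ 2) (𝓝[<] T) (𝓝 0) := by
  obtain ⟨a, haT, ha⟩ := mem_nhdsLT_iff_exists_Ioo_subset.1 hm
  refine tendsto_integral_norm_sub_sq_of_l4Criterion hν hT hcl hLH hdec hC ?_
  filter_upwards [hint, Ioo_mem_nhdsLT (max_lt haT hT)] with t hct hta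
  have htT : t < T := hta.2
  refine lintegral_Ioo_le_of_forall_Ioo_le htT fun s hs => ?_
  refine le_trans (setLIntegral_mono' measurableSet_Ioo fun τ hτ => ?_) (hct s hs)
  exact ENNReal.ofReal_le_ofReal (ha ⟨((le_max_left a 0).trans_lt hta.1).trans hτ.1, hτ.2.trans hs.2⟩)

/-! ### Forms of the conclusion -/

/-- **`L⁴` criterion ⇒ no energy jump, `eLpNorm` form** (the conclusion shape of the former stub
`stub_typeIIEnergyEquality`). [folklore] -/
theorem tendsto_eLpNorm_sub_of_l4Criterion {ν T : ℝ} (hν : 0 < ν) (hT : 0 < T)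
    {u : ℝ → EuclideanSpace ℝ (Fin 3) → EuclideanSpace ℝ (Fin 3)} {p : ℝ → EuclideanSpace ℝ (Fin 3) → ℝ}
    (hcl : IsClassicalNSSolutionOn (Ico 0 T) ν 0 u p) (hLH : IsLerayHopfOn T ν 0 (u 0) u)
    (hdec : HasRapidSpatialDecay (u 0)) {C : ℝ} (hC : 0 ≤ C)
    (hcrit : ∀ᶠ t in 𝓝[<] T, ∫⁻ τ in Ioo t T, ENNReal.ofReal (Real.sqrt (∫ x, ‖u τ x‖ ^ 4)) ≤
      ENNReal.ofReal (C * Real.sqrt (T - t))) :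
    Tendsto (fun t => eLpNorm (u t - u T) 2 volume) (𝓝[<] T) (𝓝 0) :=
  (tendsto_eLpNorm_sub_iff_tendsto_integral_norm_sub_sq hT hLH).2
    (tendsto_integral_norm_sub_sq_of_l4Criterion hν hT hcl hLH hdec hC hcrit)

end NoTerminalJolt

end Summit.NavierStokesRegularity.NavierStokesRegularity.Theorems

end
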